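import Summits.Langlands.Langlands.Theorems.CoreAdequacySplitNoAdequateLayerLiftingStubCoprimeTableLiftingBridge

/-!
# RSL `CoreAdequacySplit.NoAdequateLayerLifting` (stmt-Langlands-27954), line `birth`, stub 3/3 `stub_coprimeTableLifting` — STRUCTURAL HELPERS, part 4:
# the CONVERSE bridge 2012 → 2017 for `n ≠ 0` in `k`; the two adequacy dials COINCIDE on the coprime rows

Part 2 (`…Bridge`) proved GHT-extended / Thorne-2017 adequacy ⟹ Thorne-2012 adequacy when `n ≠ 0` in `k`.  Here the converse (GHTT, appendix to
Thorne 2012, Lemma 1; GHT 2017 §1 «if `p ∤ dim V` … the notions agree»), with no new definition: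

* `semisimpleSpan_eq_top_of_isThorneAdequate` — 2012-(iv) ⟹ the semisimple elements of `H` span `M_n(k)`: otherwise the trace-orthogonal `𝓜^⊥`
  of the span is a non-zero `k[H]`-submodule of `ad`, contained in `ad⁰` (`1 ∈ 𝓜`), so it contains a simple submodule `W ⊆ ad⁰`, and (iv) yields a
  semisimple `h`, `α`, `w ∈ W` with `tr(e_{h,α} w) ≠ 0` although `e_{h,α} ∈ 𝓜` (a polynomial in `h`) — any field, any `n`;
* `adModScalarRep_cocycles₁_le_coboundaries₁_of_isThorneAdequate` — 2012-(iii) `H¹(H, ad⁰) = 0` ⟹ `H¹(H, ad/Z) = 0` for `n ≠ 0` in `k`: the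
  trace-zero projection `π(M) = M − (tr M/n)·1` kills `Z` and commutes with conjugation, so `π ∘ (lift of a cocycle into ad/Z)` is a cocycle into
  `ad⁰`, whose bounding `M₀` bounds the original modulo `Z`;
* `isExtendedAdequate_of_isThorneAdequate` (`n ≠ 0` in `k`, any field) and `isThorneAdequate_iff_isExtendedAdequate` (`k` algebraically closed);
* on the coprime rows `ℓ ∤ n` of the residual table the dials of routes CoreAdequacySplit (SADQ, 2012) and ExtendedAdequacySplit (SXADQ, 2017)
  COINCIDE: `solvAdequateBetween_iff_extAdequateBetween`, `solvablyAdequateImage_iff_solvablyExtAdequateImage`,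
  `adequateCyclotomicImage_iff_exists_isExtendedAdequate` — so the TABLE stub is VERBATIM the coprime part of the «no extended-adequate layer»
  world, and every typed extended-adequacy engine/classification transfers to it without loss.
-/

set_option linter.dupNamespace false

namespace Summit.Langlands.Langlands.Theorems.CoreAdequacy.CoprimeTable

open scoped MatrixGroups
open Literature.NumberTheory.GaloisRepresentations
open Summit.Langlands.Langlands.Theses

universe u

section Converse

variable {k : Type u} [Field k] {n : ℕ}

/-- **2012-(iv) ⟹ GHT's span clause**: for a Thorne-2012-adequate `H ≤ GL_n(k)` the semisimple elements of `H` span `M_n(k)` (GHTT Lemma 1;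
any field, any `n`). -/
theorem semisimpleSpan_eq_top_of_isThorneAdequate {H : Subgroup (GL (Fin n) k)} (hH : Subgroup.IsThorneAdequate H) :
    Subgroup.semisimpleSpan H = ⊤ := by
  classical
  by_contra hM
  obtain ⟨W₀, hW₀⟩ := Subgroup.exists_subrepresentation_semisimpleSpan_orth H
  obtain ⟨w₀, hw₀0, hw₀⟩ := Subgroup.exists_ne_zero_semisimpleSpan_orth H hM
  -- the trace-orthogonal of `𝓜` lies in `ad⁰` since `1 ∈ 𝓜`
  have horth_tr : ∀ w : Matrix (Fin n) (Fin n) k, (∀ m ∈ Subgroup.semisimpleSpan H, (m * w).trace = 0) → w.trace = 0 := by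
    intro w hw
    have h1 := hw 1 (Subgroup.one_mem_semisimpleSpan H)
    rwa [Matrix.one_mul] at h1
  -- pull `W₀` back to a subrepresentation of `ad⁰`
  let W₁ : Subrepresentation (Subgroup.adZeroRep H) :=
    { toSubmodule := W₀.toSubmodule.comap (adZero (Fin n) k).toSubmodule.subtype
      apply_mem_toSubmodule := fun g w hw => W₀.apply_mem_toSubmodule g hw }
  have hmemW₁ : ∀ w : (adZero (Fin n) k).toSubmodule, w ∈ W₁ ↔ (w : Matrix (Fin n) (Fin n) k) ∈ W₀ := fun w => Iff.rfl
  have hW₁ne : W₁ ≠ ⊥ := by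
    intro hbot
    have hmem : (⟨w₀, (mem_adZero_toSubmodule_iff w₀).2 (horth_tr w₀ hw₀)⟩ : (adZero (Fin n) k).toSubmodule) ∈ W₁ :=
      (hmemW₁ _).2 ((hW₀ w₀).2 hw₀)
    rw [hbot] at hmem
    exact hw₀0 (congrArg Subtype.val ((Submodule.mem_bot k).1 hmem))
  obtain ⟨W, hWatom, hWle⟩ := Subrepresentation.exists_isAtom_le W₁ hW₁ne
  obtain ⟨h, hh, α, w, hw, htr⟩ := hH.exists_trace_eigenprojection_ne_zero W hWatom
  have hwW₀ : (w : Matrix (Fin n) (Fin n) k) ∈ W₀ := (hmemW₁ w).1 (hWle hw)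
  exact htr ((hW₀ _).1 hwW₀ _ (Subgroup.eigenprojectionMatrix_mem_semisimpleSpan H h hh α))

/-- The trace-zero projection kills the scalar matrices (`n ≠ 0` in `k`). -/
theorem sub_smul_one_eq_zero_of_mem_scalarMatrices (hn : (n : k) ≠ 0) {M : Matrix (Fin n) (Fin n) k} (hM : M ∈ scalarMatrices (Fin n) k) :
    M - (M.trace / n) • (1 : Matrix (Fin n) (Fin n) k) = 0 := by
  obtain ⟨c, rfl⟩ := (mem_scalarMatrices_iff M).1 hM
  rw [Matrix.trace_smul, Matrix.trace_one, Fintype.card_fin, smul_eq_mul, mul_div_cancel_right₀ _ hn, sub_self]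

/-- The trace-zero projection is additive-subtractive: `π(M − N) = π M − π N`. -/
theorem sub_smul_one_sub (hn : (n : k) ≠ 0) (M N : Matrix (Fin n) (Fin n) k) :
    (M - N) - ((M - N).trace / n) • (1 : Matrix (Fin n) (Fin n) k) =
      (M - (M.trace / n) • (1 : Matrix (Fin n) (Fin n) k)) - (N - (N.trace / n) • (1 : Matrix (Fin n) (Fin n) k)) := by
  have _ := hn
  rw [Matrix.trace_sub, sub_div, sub_smul]
  abel

/-- The trace-zero projection commutes with conjugation: `π(h M h⁻¹) = h (π M) h⁻¹`. -/
theorem adRep_sub_smul_one (H : Subgroup (GL (Fin n) k)) (g : H) (M : Matrix (Fin n) (Fin n) k) :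
    Subgroup.adRep H g M - ((Subgroup.adRep H g M).trace / n) • (1 : Matrix (Fin n) (Fin n) k) =
      Subgroup.adRep H g (M - (M.trace / n) • (1 : Matrix (Fin n) (Fin n) k)) := by
  have h1 : Subgroup.adRep H g (1 : Matrix (Fin n) (Fin n) k) = 1 := by
    rw [Subgroup.adRep_apply, Matrix.mul_one, Units.mul_inv]
  have htr : (Subgroup.adRep H g M).trace = M.trace := by
    rw [Subgroup.adRep_apply, Matrix.trace_mul_cycle, Units.inv_mul, Matrix.one_mul]
  rw [map_sub, map_smul, h1, htr]

/-- **2012-(iii) ⟹ 2017-(i, second half)**: `H¹(H, ad⁰) = 0` ⟹ `H¹(H, ad/Z) = 0` when `n ≠ 0` in `k` (lift a cocycle into `ad/Z`, project it to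
`ad⁰` by `π(M) = M − (tr M/n)·1`, bound it there, read the bound modulo `Z`). -/
theorem adModScalarRep_cocycles₁_le_coboundaries₁_of_isThorneAdequate (hn : (n : k) ≠ 0) {H : Subgroup (GL (Fin n) k)}
    (hH : Subgroup.IsThorneAdequate H) :
    groupCohomology.cocycles₁ (Rep.of (Subgroup.adModScalarRep H)) ≤ groupCohomology.coboundaries₁ (Rep.of (Subgroup.adModScalarRep H)) := by
  classical
  refine (cocycles₁_le_coboundaries₁_iff_forall _).2 fun f hf => ?_
  -- lifts of the values of `f`
  choose L hL using fun g : H => Submodule.Quotient.mk_surjective (scalarMatrices (Fin n) k) (f g)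
  -- the projected cocycle into `ad⁰`
  let f₀ : H → (adZero (Fin n) k).toSubmodule := fun g =>
    ⟨L g - ((L g).trace / n) • (1 : Matrix (Fin n) (Fin n) k), (mem_adZero_toSubmodule_iff _).2 (trace_sub_smul_one_eq_zero hn (L g))⟩
  have hf₀val : ∀ g, ((f₀ g : (adZero (Fin n) k).toSubmodule) : Matrix (Fin n) (Fin n) k) = L g - ((L g).trace / n) • (1 : Matrix (Fin n) (Fin n) k) :=
    fun g => rfl
  have hf₀ : ∀ g h : H, f₀ (g * h) = (Rep.of (Subgroup.adZeroRep H)).ρ g (f₀ h) + f₀ g := by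
    intro g h
    apply Subtype.ext
    rw [Rep.of_ρ, Submodule.coe_add, Subgroup.coe_adZeroRep_apply, hf₀val, hf₀val, hf₀val, ← Subgroup.adRep_apply]
    -- the defect `L (g h) − (g • L h + L g)` is scalar
    have e : Submodule.Quotient.mk (p := scalarMatrices (Fin n) k) (L (g * h)) =
        Submodule.Quotient.mk (p := scalarMatrices (Fin n) k) (Subgroup.adRep H g (L h) + L g) := by
      rw [hL, hf g h, Rep.of_ρ, Submodule.Quotient.mk_add, ← hL h, ← hL g]
      rfl
    have hdiff : L (g * h) - (Subgroup.adRep H g (L h) + L g) ∈ scalarMatrices (Fin n) k := (Submodule.Quotient.eq _).1 e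
    have hπ := sub_smul_one_eq_zero_of_mem_scalarMatrices hn hdiff
    rw [sub_smul_one_sub hn] at hπ
    rw [← adRep_sub_smul_one, ← sub_eq_zero, ← hπ, Matrix.trace_add, add_div, add_smul]
    abel
  obtain ⟨M₀, hM₀⟩ := (cocycles₁_le_coboundaries₁_iff_forall (Rep.of (Subgroup.adZeroRep H))).1 hH.cocycles₁_le_coboundaries₁ f₀ hf₀
  refine ⟨Submodule.Quotient.mk (p := scalarMatrices (Fin n) k) (M₀ : Matrix (Fin n) (Fin n) k), fun g => ?_⟩
  have hg := congrArg Subtype.val (hM₀ g)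
  rw [Rep.of_ρ, Submodule.coe_sub, Subgroup.coe_adZeroRep_apply, hf₀val, ← Subgroup.adRep_apply] at hg
  -- `f g = [L g] = [π (L g)] = [g M₀ g⁻¹ − M₀]`
  have hscal : L g - (L g - ((L g).trace / n) • (1 : Matrix (Fin n) (Fin n) k)) ∈ scalarMatrices (Fin n) k := by
    rw [sub_sub_cancel]
    exact smul_one_mem_scalarMatrices _ _
  rw [← hL g, Rep.of_ρ, Subgroup.adModScalarRep_apply_mk, ← Submodule.Quotient.mk_sub, Submodule.Quotient.eq, ← Subgroup.adRep_apply, ← hg]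
  exact hscal

/-- **CONVERSE BRIDGE: Thorne 2012 (Def. 2.3) ⟹ GHT-extended adequacy, for `n ≠ 0` in `k`** (any field). -/
theorem isExtendedAdequate_of_isThorneAdequate (hn : (n : k) ≠ 0) {H : Subgroup (GL (Fin n) k)} (hH : Subgroup.IsThorneAdequate H) :
    Subgroup.IsExtendedAdequate H :=
  ⟨hH.addMonoidHom_eq_zero, adModScalarRep_cocycles₁_le_coboundaries₁_of_isThorneAdequate hn hH, semisimpleSpan_eq_top_of_isThorneAdequate hH⟩

/-- **THE TWO ADEQUACY NOTIONS AGREE OFF THE SLAB**: over an algebraically closed field with `n ≠ 0` in `k`, Thorne 2012 Def. 2.3 ⟺ GHT 2017 §1 /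
Thorne 2017 Def. 2.20 (parts 2 and 4 together). -/
theorem isThorneAdequate_iff_isExtendedAdequate [IsAlgClosed k] (hn : (n : k) ≠ 0) (H : Subgroup (GL (Fin n) k)) :
    Subgroup.IsThorneAdequate H ↔ Subgroup.IsExtendedAdequate H :=
  ⟨isExtendedAdequate_of_isThorneAdequate hn, isThorneAdequate_of_isExtendedAdequate hn⟩

/-- The 2012 and 2017 notions also agree with Thorne's printed Def. 2.20 off the slab (any field for ⟸, `n ≠ 0` in `k`; ⟹ needs eigenvalues in
`k`, so `k` algebraically closed). -/
theorem isThorneAdequate_iff_isThorne2017Adequate [IsAlgClosed k] (hn : (n : k) ≠ 0) (H : Subgroup (GL (Fin n) k)) :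
    Subgroup.IsThorneAdequate H ↔ Subgroup.IsThorne2017Adequate H := by
  rw [isThorneAdequate_iff_isExtendedAdequate hn, Subgroup.isThorne2017Adequate_iff_isExtendedAdequate]

/-- **Layer dials agree off the slab**: `SolvAdequateBetween I ↔ ExtAdequateBetween I` (`k` algebraically closed, `n ≠ 0` in `k`). -/
theorem solvAdequateBetween_iff_extAdequateBetween [IsAlgClosed k] (hn : (n : k) ≠ 0) (I : Subgroup (GL (Fin n) k)) :
    SolvAdequateBetween I ↔ ExtAdequacy.ExtAdequateBetween I := by
  refine ⟨fun ⟨P, J, hP, hPJ, hJI, hirr, hadq⟩ => ?_, solvAdequateBetween_of_extAdequateBetween hn⟩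
  exact ⟨J, LieDefect.aboveCore_iff_exists_isPerfectCore.2 ⟨P, hP, hPJ⟩, hJI, hirr, isExtendedAdequate_of_isThorneAdequate hn hadq⟩

end Converse

/-! ## The coprime rows: SADQ ⟺ SXADQ, ADQ ⟺ «extended-adequate image» -/

section Coprime

variable {K : Type} [Field K] [NumberField K] {ℓ : ℕ} [Fact ℓ.Prime] {n : ℕ}

/-- **On the coprime rows the dials SADQ (route CoreAdequacySplit) and SXADQ (route ExtendedAdequacySplit) coincide.** -/
theorem solvablyAdequateImage_iff_solvablyExtAdequateImage (hℓn : ¬ ℓ ∣ n) (ρ : FramedGaloisRep K (PadicAlgCl ℓ) n) :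
    SolvablyAdequateImage ρ ↔ ExtAdequacy.SolvablyExtAdequateImage ρ := by
  haveI : IsAlgClosed (padicAlgClResidueField ℓ) := Literature.RingTheory.Valuation.isAlgClosed_residueField (padicAlgClIntegers ℓ)
  rw [solvablyAdequateImage_iff, ExtAdequacy.solvablyExtAdequateImage_iff]
  refine exists_congr fun τ => and_congr_right fun _ => and_congr_right fun _ => ?_
  exact solvAdequateBetween_iff_extAdequateBetween (natCast_ne_zero_of_not_dvd hℓn) τ.range

/-- **On the coprime rows ADQ ⟺ the image of some absolutely irreducible reduction is EXTENDED-adequate** (the literal image hypothesis of Thorne's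
Math. Z. 2017 Thm 5.1, as typed in the tree's `FramedRep.HasExtendedAdequateImage` vocabulary at subgroup level). -/
theorem adequateCyclotomicImage_iff_exists_isExtendedAdequate (hℓn : ¬ ℓ ∣ n) (ρ : FramedGaloisRep K (PadicAlgCl ℓ) n) :
    AdequateCyclotomicImage ρ ↔ ∃ τ : Field.absoluteGaloisGroup (CyclotomicField ℓ K) →* GL (Fin n) (padicAlgClResidueField ℓ),
      (ρ.restrictField (CyclotomicField ℓ K)).IsReductionOf (RingHom.id _) τ ∧ IsAbsIrreducible τ ∧ Subgroup.IsExtendedAdequate τ.range := by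
  haveI : IsAlgClosed (padicAlgClResidueField ℓ) := Literature.RingTheory.Valuation.isAlgClosed_residueField (padicAlgClIntegers ℓ)
  refine exists_congr fun τ => and_congr_right fun _ => and_congr_right fun _ => ?_
  exact isThorneAdequate_iff_isExtendedAdequate (natCast_ne_zero_of_not_dvd hℓn) τ.range

/-- **The TABLE's dial hypotheses in extended form** (coprime row): `¬ADQ ∧ ¬SADQ` ⟺ «no absolutely irreducible reduction has extended-adequate
image» ∧ ¬SXADQ. -/
theorem table_dials_iff_extended (hℓn : ¬ ℓ ∣ n) (ρ : FramedGaloisRep K (PadicAlgCl ℓ) n) :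
    (¬ AdequateCyclotomicImage ρ ∧ ¬ SolvablyAdequateImage ρ) ↔
      ((¬ ∃ τ : Field.absoluteGaloisGroup (CyclotomicField ℓ K) →* GL (Fin n) (padicAlgClResidueField ℓ),
        (ρ.restrictField (CyclotomicField ℓ K)).IsReductionOf (RingHom.id _) τ ∧ IsAbsIrreducible τ ∧ Subgroup.IsExtendedAdequate τ.range) ∧
        ¬ ExtAdequacy.SolvablyExtAdequateImage ρ) := by
  rw [adequateCyclotomicImage_iff_exists_isExtendedAdequate hℓn, solvablyAdequateImage_iff_solvablyExtAdequateImage hℓn]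

end Coprime

end Summit.Langlands.Langlands.Theorems.CoreAdequacy.CoprimeTable
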